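import Summits.ResolutionOfSingularities.ResolutionOfSingularities.Theorems.UniformComplexityCampaignW82AlgClosedStep
import Summits.ResolutionOfSingularities.ResolutionOfSingularities.Theorems.UniformComplexityPrimeModelTransferSpecializationGraded
import Summits.ResolutionOfSingularities.ResolutionOfSingularities.Theorems.UniformComplexityPrimeModelTransferAlgClosedTower
import Mathlib.FieldTheory.IsAlgClosed.Basic
import HarnessLib

/-!
# Crux `PrimeModelTransfer` (stmt-ResolutionOfSingularities-8933), door 2 of slot W8.2:
# the GRADED all-or-nothing form equals the GRADED one-step climb on the diagonal `(n, n)`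

Route `ResolutionOfSingularities/UniformComplexity`. The typer's graded OURS statements
`CampaignW82.AlgClosedAllOrNothingDimLe p m n` and `CampaignW82.ClimbAlgClosedStepDimLe p m n`
(Theorems/UniformComplexityCampaignW82AlgClosedStep.lean, p486396) satisfy
`AlgClosedAllOrNothingDimLe → ClimbAlgClosedStepDimLe` at every grade (typer's anchor). Here the
CONVERSE on the diagonal, «intended, not proved» in the typer's docstring:

* `CampaignW82.algClosedAllOrNothingDimLe_iff_climbAlgClosedStepDimLe` — for prime `p` and every
  dimension bound `n`, `AlgClosedAllOrNothingDimLe p n n ↔ ClimbAlgClosedStepDimLe p n n`: **in each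
  dimension `n`, "resolution in dimension `≤ n` over algebraically closed fields of characteristic
  `p` is all-or-nothing" is EQUIVALENT to the graded one-step climb between algebraically closed
  fields.** First open grade: `n = 4`.

Proof of «←»: from `Res_{≤n}(M)`, graded specialization
(`PrimeModelTransfer.integralResUpToDim_of_integralResUpToDim_extension`, p487796) along
`IsAlgClosed.lift : 𝔽̄_p^K → M` gives `Res_{≤n}` over the algebraic closure of
`𝔽_p` in the target `K`; the graded tower of algebraically closed subfields
(`exists_isAlgClosed_subfield_resUpToDim_of_step`) reaches every finite subset of `K`; the graded
descent `hasResolution_of_perfectSubfields_upToDim` (copy of p470438's descent with the dimension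
bookkeeping `dim X_L = dim X`, `PrimeModelTransfer.topologicalKrullDim_baseChange_eq`) concludes.

[OURS · LADDER-RESOLUTION L1, slot W8.2 (prime-field / universality transfer), door 2
UniformComplexity] Theorems over the summit's own route; NOT statements of, and attributing
nothing to, Hironaka's 2017 manuscript. AI-written; weaker than expert review. Theses-free module.
Barrier bookkeeping: only SMOOTH models are base-changed (descent over perfect subfields;
specialization).
-/

noncomputable section

set_option linter.dupNamespace false -- mandated namespace of this single-conjunct summit

open CategoryTheory CategoryTheory.Limits AlgebraicGeometry TopologicalSpace
open Literature.AlgebraicGeometry.Resolution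

namespace Summit.ResolutionOfSingularities.ResolutionOfSingularities.Theorems.CampaignW82

/-! ## Graded descent to perfect subfields -/

/-- **Graded descent to perfect subfields** (the dimension-`≤ n` form of
`PrimeModelTransfer.hasResolution_of_perfectSubfields`, p470438): over a perfect field `E`, if
every finite `s ⊆ E` lies in a perfect subfield `L` over which every integral separated scheme of
finite type of dimension `≤ n` has a resolution, then every integral separated `E`-scheme of finite
type of dimension `≤ n` has a resolution. Same proof (spread out to a finitely generated subfield
`K₀ ⊆ L`, resolve the model over `L`, base-change the smooth resolution to `E`), with
`dim (X₀ ×_{K₀} L) = dim X` (`PrimeModelTransfer.topologicalKrullDim_baseChange_eq`).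
[cite: Liu2002, Prop. 3.2.7 and Cor. 4.3.33] -/
theorem hasResolution_of_perfectSubfields_upToDim (E : Type) [Field E] [PerfectField E]
    (n : WithBot ℕ∞)
    (h : ∀ s : Finset E, ∃ L : Subfield E, (↑s : Set E) ⊆ L ∧ PerfectField L ∧
      ∀ (X : Scheme.{0}) (f : X ⟶ Spec (.of L)), IsSeparated f → LocallyOfFiniteType f →
        QuasiCompact f → IsIntegral X → topologicalKrullDim X ≤ n → Scheme.HasResolution X)
    (X : Scheme.{0}) (f : X ⟶ Spec (.of E)) (hs : IsSeparated f) (hl : LocallyOfFiniteType f)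
    (hq : QuasiCompact f) (hX : IsIntegral X) (hdim : topologicalKrullDim X ≤ n) :
    Scheme.HasResolution X := by
  -- adapted from Theorems/UniformComplexityPrimeModelTransferAlgClosedTower.lean (p470438)
  classical
  obtain ⟨K₀, s, hK₀, X₀, f₀, hsep, hlft, hqc, -, ⟨e⟩⟩ :=
    Theorems.stub_fgModel E X f hs hl hq inferInstance
  obtain ⟨L, hsL, hLperf, hLres⟩ := h s
  have hL : K₀ ≤ L := by
    rw [hK₀]
    exact Subfield.closure_le.2 hsL
  haveI : PerfectField L := hLperf
  let iL : Spec (.of L) ⟶ Spec (.of K₀) := Spec.map (CommRingCat.ofHom (Subfield.inclusion hL))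
  let jL : Spec (.of E) ⟶ Spec (.of L) := Spec.map (CommRingCat.ofHom L.subtype)
  let XL : Scheme.{0} := pullback f₀ iL
  let gL : XL ⟶ Spec (.of L) := pullback.snd f₀ iL
  have hK : L.subtype.comp (Subfield.inclusion hL) = K₀.subtype := RingHom.ext fun _ => rfl
  have e' : jL ≫ iL = Spec.map (CommRingCat.ofHom K₀.subtype) := by
    rw [← Spec.map_comp, ← CommRingCat.ofHom_comp, hK]
  let eK : pullback gL jL ≅ pullback f₀ (Spec.map (CommRingCat.ofHom K₀.subtype)) :=
    pullbackLeftPullbackSndIso f₀ iL jL ≪≫ pullback.congrHom rfl e'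
  haveI : Flat jL := by
    haveI : Module.Free L E := Module.Free.of_divisionRing L E
    haveI : Module.Flat L E := Module.Flat.of_free
    rw [Flat.SpecMap_iff, CommRingCat.hom_ofHom]
    exact RingHom.flat_algebraMap_iff.mpr ‹Module.Flat L E›
  haveI : Surjective jL := by
    haveI : Subsingleton ↥(Spec (CommRingCat.of L)) :=
      inferInstanceAs (Subsingleton (PrimeSpectrum L))
    haveI : Nonempty ↥(Spec (CommRingCat.of E)) := inferInstanceAs (Nonempty (PrimeSpectrum E))
    infer_instance
  let c : X ⟶ XL := e.hom ≫ eK.inv ≫ pullback.fst gL jL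
  haveI : Flat c := inferInstance
  haveI : Surjective c := inferInstance
  haveI : IsIntegral XL := by
    haveI : IsReduced XL :=
      Literature.AlgebraicGeometry.Morphisms.isReduced_of_flat_of_surjective c
    haveI : IrreducibleSpace XL := c.surjective.irreducibleSpace c.continuous
    exact isIntegral_of_irreducibleSpace_of_isReduced XL
  haveI : IsSeparated gL := inferInstance
  haveI : LocallyOfFiniteType gL := inferInstance
  haveI : QuasiCompact gL := inferInstance
  -- the dimension bookkeeping: `dim X_L = dim (X_L ×_L E) = dim X`
  have hdimL : topologicalKrullDim XL ≤ n := by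
    haveI : Nonempty ↥(pullback gL jL) := by
      obtain ⟨x⟩ := (inferInstance : Nonempty X)
      exact ⟨(e.hom ≫ eK.inv) x⟩
    haveI : IsIntegral (pullback gL jL : Scheme.{0}) :=
      isIntegral_of_isOpenImmersion (eK.hom ≫ e.inv)
    letI : Algebra L E := L.subtype.toAlgebra
    have H : IsPullback (pullback.fst gL jL) (pullback.snd gL jL) gL
        (Spec.map (CommRingCat.ofHom (algebraMap L E))) := IsPullback.of_hasPullback gL jL
    rw [← PrimeModelTransfer.topologicalKrullDim_baseChange_eq L E H,
      IsHomeomorph.topologicalKrullDim_eq _ (Scheme.homeoOfIso (e ≪≫ eK.symm)).symm.isHomeomorph]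
    exact hdim
  obtain ⟨Y, π, hres⟩ := hLres XL gL inferInstance inferInstance inferInstance inferInstance hdimL
  haveI := hres.isProper
  haveI : Smooth (π ≫ gL) := smooth_of_isRegular_of_perfectField (π ≫ gL) hres.isRegular
  have hreg : Scheme.IsRegular (pullback (π ≫ gL) jL) := fun y =>
    isRegularLocalRing_stalk_of_smooth_of_field (pullback.snd (π ≫ gL) jL) y
  have H := Theorems.stub_resolutionOfRobustModel E K₀ L hL X₀ f₀ hsep hlft hqc Y π hres.isProper
    hres.isBirational hreg
  exact H.of_iso e.inv

/-! ## Graded crux hypothesis and graded tower -/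

/-- **Graded crux hypothesis from graded resolution over any algebraically closed field**: if
over an algebraically closed `M` of characteristic `p` every integral separated scheme of finite
type of dimension `≤ n` has a resolution, then the same holds over every algebraically closed `k`
of characteristic `p` algebraic over `𝔽_p` (`k` embeds into `M` by `IsAlgClosed.lift`; graded
specialization `PrimeModelTransfer.integralResUpToDim_of_integralResUpToDim_extension`).
[folklore] -/
theorem resUpToDim_primeClosure_of_isAlgClosed (p : ℕ) [Fact p.Prime] (n : WithBot ℕ∞)
    (M : Type) [Field M] [CharP M p] [IsAlgClosed M]
    (hM : ∀ (X : Scheme.{0}) (f : X ⟶ Spec (.of M)), IsSeparated f → LocallyOfFiniteType f →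
      QuasiCompact f → IsIntegral X → topologicalKrullDim X ≤ n → Scheme.HasResolution X)
    (k : Type) [Field k] [CharP k p] [IsAlgClosed k] (hk : ∀ x : k, ∃ m : ℕ, 0 < m ∧ x ^ p ^ m = x)
    (X : Scheme.{0}) (f : X ⟶ Spec (.of k)) (hs : IsSeparated f) (hl : LocallyOfFiniteType f)
    (hq : QuasiCompact f) (hX : IsIntegral X) (hd : topologicalKrullDim X ≤ n) :
    Scheme.HasResolution X := by
  letI : Algebra (ZMod p) k := ZMod.algebra k p
  letI : Algebra (ZMod p) M := ZMod.algebra M p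
  haveI : Algebra.IsAlgebraic (ZMod p) k := by
    refine ⟨fun x => ?_⟩
    obtain ⟨m, hm, hx⟩ := hk x
    have hdeg : 1 < p ^ m := Nat.one_lt_pow hm.ne' (Fact.out : p.Prime).one_lt
    refine ⟨Polynomial.X ^ (p ^ m) - Polynomial.X, ?_, ?_⟩
    · intro h
      have := congrArg Polynomial.natDegree h
      rw [Polynomial.natDegree_sub_eq_left_of_natDegree_lt (by simpa using hdeg),
        Polynomial.natDegree_X_pow, Polynomial.natDegree_zero] at this
      exact (Nat.pos_of_ne_zero (by omega) |>.ne') this |>.elim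
    · simp [hx]
  let ι : k →ₐ[ZMod p] M := IsAlgClosed.lift
  letI : Algebra k M := ι.toRingHom.toAlgebra
  haveI : PerfectField M := IsAlgClosed.perfectField M
  exact PrimeModelTransfer.integralResUpToDim_of_integralResUpToDim_extension k M n hM X f hs hl hq
    hX hd

/-- **Graded tower of algebraically closed subfields**: for `K` algebraically closed of
characteristic `p`, graded resolution (dimension `≤ n`) over the algebraically closed fields
algebraic over `𝔽_p` and the graded one-step climb `ClimbAlgClosedStepDimLe p n n` give, for
every finite `S ⊆ K`, an algebraically closed subfield `A ⊇ S` with resolution in dimension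
`≤ n` (induction on `S`, as in p470438 / p485462). [folklore] -/
theorem exists_isAlgClosed_subfield_resUpToDim_of_step (p : ℕ) [Fact p.Prime] (n : WithBot ℕ∞)
    (K : Type) [Field K] [CharP K p] [IsAlgClosed K]
    (hA : ∀ (k : Type) [Field k] [CharP k p] [IsAlgClosed k],
      (∀ x : k, ∃ m : ℕ, 0 < m ∧ x ^ p ^ m = x) →
      ∀ (X : Scheme.{0}) (f : X ⟶ Spec (.of k)), IsSeparated f → LocallyOfFiniteType f →
        QuasiCompact f → IsIntegral X → topologicalKrullDim X ≤ n → Scheme.HasResolution X)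
    (hstep : ClimbAlgClosedStepDimLe p n n) (S : Finset K) :
    ∃ A : Subfield K, (↑S : Set K) ⊆ A ∧ IsAlgClosed A ∧
      ∀ (X : Scheme.{0}) (f : X ⟶ Spec (.of A)), IsSeparated f → LocallyOfFiniteType f →
        QuasiCompact f → IsIntegral X → topologicalKrullDim X ≤ n → Scheme.HasResolution X := by
  classical
  letI : Algebra (ZMod p) K := ZMod.algebra K p
  induction S using Finset.induction_on with
  | empty =>
    let A₀ : IntermediateField (ZMod p) K := algebraicClosure (ZMod p) K
    haveI : IsAlgClosed A₀ := IsAlgClosure.isAlgClosed (ZMod p)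
    haveI : CharP A₀ p := (algebraMap A₀ K).charP (algebraMap A₀ K).injective p
    have halg : ∀ x : A₀, ∃ m : ℕ, 0 < m ∧ x ^ p ^ m = x := fun x =>
      PrimeModelTransfer.pow_prime_pow_eq_self_of_isAlgebraic p x
        (Algebra.IsAlgebraic.isAlgebraic x)
    exact ⟨A₀.toSubfield, by simp, inferInstanceAs (IsAlgClosed A₀),
      fun X f hs hl hq hX hd => hA A₀ halg X f hs hl hq hX hd⟩
  | insert t S _ ih =>
    obtain ⟨A, hSA, hAc, hAres⟩ := ih
    haveI : IsAlgClosed A := hAc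
    haveI : CharP A p := (algebraMap A K).charP (algebraMap A K).injective p
    let E : IntermediateField A K := IntermediateField.adjoin A ({t} : Set K)
    let L : IntermediateField E K := algebraicClosure E K
    haveI : IsAlgClosed L := IsAlgClosure.isAlgClosed E
    refine ⟨L.toSubfield, ?_, inferInstanceAs (IsAlgClosed L), ?_⟩
    · have hEL : ∀ x : K, x ∈ E → x ∈ L.toSubfield := fun x hx => by
        have := L.algebraMap_mem ⟨x, hx⟩
        simpa using this
      rw [Finset.coe_insert, Set.insert_subset_iff]
      refine ⟨hEL t (IntermediateField.mem_adjoin_simple_self A t), fun x hx => hEL x ?_⟩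
      exact E.algebraMap_mem (⟨x, hSA hx⟩ : A)
    · exact fun X f hs hl hq hX hd => hstep A hAres K t X f hs hl hq hX hd

/-! ## The diagonal equivalence -/

/-- **`AlgClosedAllOrNothingDimLe p n n ⟺ ClimbAlgClosedStepDimLe p n n`** for prime `p` and
every `n`: on the diagonal, the graded all-or-nothing form and the graded one-step climb between
algebraically closed fields are EQUIVALENT («→» is the typer's anchor
`climbAlgClosedStepDimLe_of_algClosedAllOrNothingDimLe`; «←»: graded crux hypothesis by graded
specialization, graded tower, graded descent). In particular the first open grade of door 2 is
`ClimbAlgClosedStepDimLe p 4 4 ⟺ AlgClosedAllOrNothingDimLe p 4 4`. [folklore] -/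
theorem algClosedAllOrNothingDimLe_iff_climbAlgClosedStepDimLe {p : ℕ} (hp : p.Prime)
    (n : WithBot ℕ∞) : AlgClosedAllOrNothingDimLe p n n ↔ ClimbAlgClosedStepDimLe p n n := by
  haveI : Fact p.Prime := ⟨hp⟩
  refine ⟨climbAlgClosedStepDimLe_of_algClosedAllOrNothingDimLe, fun h => ?_⟩
  intro M _ _ _ hM K _ _ _ X f hs hl hq hX hd
  haveI : PerfectField K := IsAlgClosed.perfectField K
  refine hasResolution_of_perfectSubfields_upToDim K n (fun s => ?_) X f hs hl hq hX hd
  obtain ⟨A, hsA, hAc, hAres⟩ := exists_isAlgClosed_subfield_resUpToDim_of_step p n K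
    (fun k _ _ _ hk => resUpToDim_primeClosure_of_isAlgClosed p n M hM k hk) h s
  haveI : IsAlgClosed A := hAc
  exact ⟨A, hsA, IsAlgClosed.perfectField A, hAres⟩

end Summit.ResolutionOfSingularities.ResolutionOfSingularities.Theorems.CampaignW82

end
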